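import Summits.NavierStokesRegularity.NavierStokesRegularity.Theorems.TerminalTraceTypeITraceScarL3GaugedPressure
import Summits.NavierStokesRegularity.NavierStokesRegularity.Theorems.TerminalTraceTypeITraceScarL3RegularPointExtinction
import Summits.NavierStokesRegularity.NavierStokesRegularity.Theorems.TerminalTraceTypeITraceScarL3LayerDecay
import Literature.Analysis.FluidPDE.ESSLocalHolderRepresentative
import Literature.Analysis.FluidPDE.NSBoundedHigherRegularityQuantProofs

set_option linter.dupNamespace false

/-!
# No local `L²` concentration at the blow-up time, I-a: Lipschitz slices at regular top points
# (nsreg-C26-p1 g3)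

Setting of item `TerminalTrace.TypeITraceScarL3` (stmt-NavierStokesRegularity-18385) at unit
viscosity: `(u,p)` classical on `[0,T) × ℝ³` and Leray–Hopf on `[0,T]` (so every slice `u(t)`,
`0 ≤ t ≤ T`, is in `L²` and `t ↦ ∫⟪u(t), w⟫` is continuous on `(0,T]` for `w ∈ L²`).  A point `y`
is a REGULAR top point if `u` is essentially bounded on some backward cylinder `Q_r(T,y)`.

This file: `exists_lipschitz_slices_near_regular_top` (the uniform spatial Lipschitz bound up to the top
at a regular top point).  Part I-b (`…NoConcentrationRegular.lean`) proves
`localEnergy_sub_top_le_of_regular_unit`: at a regular top point `y` there is a radius `r > 0`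
such that `∫_{B(y,r)} |u(t) − u(T)|² → 0` as `t → T⁻` (quantified form: for every `θ > 0` the
integral is `≤ θ` on a final interval).  Proof (no Arzelà–Ascoli): on a late cylinder about `(T,y)`
the slices `u(t,·)` are `K`-Lipschitz UNIFORMLY in `t < T` — higher regularity of bounded suitable
weak solutions (`NSBoundedHigherRegularityBounds_holds`, Seregin–Šverák 2009 §2) applied to the pair
`(u, q)` with Tao's gauged pressure `q` (`gaugedPressure_suitable_and_memLp`: `q ∈ L^{3/2}` of the
cylinder), the smooth representative being `u` itself below `T` — while the bump pairings
`∫⟪u(t), ψ_h(· − k)eᵢ⟫` are continuous in `t` up to `T` (Leray–Hopf weak continuity); an `h`-net of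
the ball turns the two into a UNIFORM Cauchy estimate `sup_{B(y,r)} |u(t) − u(t')| ≤ θ₀` for
`t, t' ∈ (t₀,T)`, and the passage `t' → T⁻` is done in the weak topology with Young's inequality
(`∫_B ⟪u(t) − u(t'), u(t) − u(T)⟫ → ∫_B |u(t) − u(T)|²`).  Part II (`…NoConcentration.lean`) adds the
Type-I Morrey bound and CKN's `ℋ¹`-nullity of the top singular set to reach EVERY point.

WHAT THIS IS NOT: no statement at singular points here; not 18385; NOT Navier–Stokes regularity.
-/

noncomputable section

open MeasureTheory Set Function Metric Filter Topology Literature.Analysis.FluidPDE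
open scoped ENNReal NNReal RealInnerProductSpace

namespace Summit.NavierStokesRegularity.NavierStokesRegularity.Theorems.TypeITraceScarL3

/-- Pairings of `L²` fields are integrable (`|⟪a, w⟫| ≤ ‖a‖‖w‖` and Hölder). [folklore] -/
theorem integrable_inner_of_memLp_two {X : Type*} [MeasurableSpace X] {μ : Measure X}
    {E : Type*} [NormedAddCommGroup E] [InnerProductSpace ℝ E] {a w : X → E}
    (ha : MemLp a 2 μ) (hw : MemLp w 2 μ) :
    Integrable (fun x => ⟪a x, w x⟫) μ :=
  (ha.norm.integrable_mul hw.norm).mono' (ha.aestronglyMeasurable.inner hw.aestronglyMeasurable)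
    (ae_of_all _ fun x => norm_inner_le_norm (a x) (w x))

/-- **Uniform spatial Lipschitz bound up to the top at a regular top point** (higher regularity of
bounded suitable weak solutions, fed the Tao-gauged pair).  For a classical solution `(u,p)` on
`[0,T)` which is Leray–Hopf on `[0,T)` and essentially bounded on a backward cylinder `Q_{r₀}(T,y)`,
there are `r₁ ∈ (0, r₀]`, `a ∈ (0,T)` and `K ≥ 0` with `‖u(t,w) − u(t,z)‖ ≤ K‖w − z‖` for all
`t ∈ (a,T)` and `w, z ∈ B(y, r₁/2)`.
[cite: SereginSverak2009, §2 p. 8; Tao2011, Lemma 4.1 (i)] -/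
theorem exists_lipschitz_slices_near_regular_top {T : ℝ} (hT : 0 < T)
    {u : ℝ → EuclideanSpace ℝ (Fin 3) → EuclideanSpace ℝ (Fin 3)}
    {p : ℝ → EuclideanSpace ℝ (Fin 3) → ℝ}
    (hcl : IsClassicalNSSolutionOn (Ico 0 T) 1 0 u p) (hLH : IsLerayHopfOn T 1 0 (u 0) u)
    {y : EuclideanSpace ℝ (Fin 3)} {r₀ : ℝ} (hr₀ : 0 < r₀)
    (hfin₀ : eLpNorm (uncurry u) ∞
      (volume.restrict (parabolicCylinder r₀ ((T, y) : ℝ × EuclideanSpace ℝ (Fin 3)))) ≠ ∞) :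
    ∃ r₁ a K : ℝ, 0 < r₁ ∧ r₁ ≤ r₀ ∧ r₁ ≤ 1 ∧ 0 < a ∧ a < T ∧ 0 ≤ K ∧
      ∀ t ∈ Ioo a T, ∀ w ∈ ball y (r₁ / 2), ∀ z ∈ ball y (r₁ / 2),
        ‖u t w - u t z‖ ≤ K * ‖w - z‖ := by
  -- ### the radius `r₁ ≤ min(r₀, 1, √T)` and the bound `L` on `Q₁ = Q_{r₁}(T,y)`
  set r₁ : ℝ := min r₀ (min 1 (Real.sqrt T)) with hr₁
  have hr₁pos : 0 < r₁ := lt_min hr₀ (lt_min one_pos (Real.sqrt_pos.2 hT))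
  have hr₁r₀ : r₁ ≤ r₀ := min_le_left _ _
  have hr₁le1 : r₁ ≤ 1 := (min_le_right _ _).trans (min_le_left _ _)
  have hr₁T : r₁ ^ 2 ≤ T := by
    have h1 : r₁ ≤ Real.sqrt T := (min_le_right _ _).trans (min_le_right _ _)
    calc r₁ ^ 2 ≤ (Real.sqrt T) ^ 2 := pow_le_pow_left₀ hr₁pos.le h1 2
      _ = T := Real.sq_sqrt hT.le
  set Q₁ : Set (ℝ × EuclideanSpace ℝ (Fin 3)) :=
    parabolicCylinder r₁ (((T : ℝ), y) : ℝ × EuclideanSpace ℝ (Fin 3)) with hQ₁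
  have hfin : eLpNorm (uncurry u) ∞ (volume.restrict Q₁) ≠ ∞ := by
    have hle : eLpNorm (uncurry u) ∞ (volume.restrict Q₁) ≤ eLpNorm (uncurry u) ∞
        (volume.restrict (parabolicCylinder r₀ (((T : ℝ), y) : ℝ × EuclideanSpace ℝ (Fin 3)))) :=
      eLpNorm_mono_measure _
        (Measure.restrict_mono (parabolicCylinder_mono hr₁pos.le hr₁r₀ _) le_rfl)
    exact ne_top_of_le_ne_top hfin₀ hle
  set L : ℝ := (eLpNorm (uncurry u) ∞ (volume.restrict Q₁)).toReal with hL
  have hbdQ : ∀ᵐ z ∂(volume.restrict Q₁), ‖u z.1 z.2‖ ≤ L := by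
    filter_upwards [enorm_ae_le_eLpNormEssSup (uncurry u) (volume.restrict Q₁)] with z hz
    rw [← eLpNorm_exponent_top] at hz
    calc ‖u z.1 z.2‖ = ‖uncurry u z‖ₑ.toReal := (toReal_enorm _).symm
      _ ≤ L := ENNReal.toReal_mono hfin hz
  -- ### Tao's gauged pressure on `Q₁`: suitability and the `L^{3/2}` bound
  obtain ⟨hswq, hq32⟩ := gaugedPressure_suitable_and_memLp one_pos hT hcl hLH y hr₁T
  set q : ℝ → EuclideanSpace ℝ (Fin 3) → ℝ := fun t x => p t x - (p t 0 - normalisedPressure (u t) 0)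
    with hq_def
  have hq32' : ∫⁻ w in Q₁, ‖q w.1 w.2‖ₑ ^ (3 / 2 : ℝ) < ∞ := by
    have h32ne : (3 / 2 : ℝ≥0∞) ≠ ∞ := ENNReal.div_ne_top (by norm_num) (by norm_num)
    have h1 := lintegral_rpow_enorm_lt_top_of_eLpNorm_lt_top (by norm_num) h32ne hq32.eLpNorm_lt_top
    have h32 : ((3 / 2 : ℝ≥0∞)).toReal = (3 / 2 : ℝ) := by norm_num
    rw [h32] at h1
    exact h1
  set P : ℝ≥0 := (∫⁻ w in Q₁, ‖q w.1 w.2‖ₑ ^ (3 / 2 : ℝ)).toNNReal with hP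
  have hqP : ∫⁻ w in Q₁, ‖q w.1 w.2‖ₑ ^ (3 / 2 : ℝ) ≤ P := by
    rw [hP, ENNReal.coe_toNNReal hq32'.ne]
  -- ### the late region `(a, T) × B(y, r₁/2)` and the small cylinders inside `Q₁`
  set a : ℝ := T - 3 / 4 * r₁ ^ 2 with ha
  have ha_pos : 0 < a := by
    rw [ha]; nlinarith
  have ha_lt : a < T := by
    have : 0 < r₁ ^ 2 := by positivity
    rw [ha]; linarith
  set S : Set (EuclideanSpace ℝ (Fin 3)) := ball y (r₁ / 2) with hS
  set ρ : ℝ := r₁ / 4 with hρ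
  have hρpos : 0 < ρ := by positivity
  have hcyl : ∀ z ∈ Ioo a T ×ˢ S,
      parabolicCylinder (2 * ρ) ((min (z.1 + ρ ^ 2) T, z.2) : ℝ × EuclideanSpace ℝ (Fin 3)) ⊆ Q₁ := by
    rintro ⟨t, x⟩ ⟨ht, hx⟩ ⟨s, w⟩ hsw
    rw [mem_parabolicCylinder] at hsw
    obtain ⟨⟨hs1, hs2⟩, hw⟩ := hsw
    simp only at hs1 hs2 hw
    rw [hQ₁, mem_parabolicCylinder]
    refine ⟨⟨?_, lt_of_lt_of_le hs2 (min_le_right _ _)⟩, ?_⟩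
    · have h1 : a < min (t + ρ ^ 2) T := lt_min (by linarith [ht.1, sq_nonneg ρ]) (ht.1.trans ht.2)
      have h2 : (2 * ρ) ^ 2 = r₁ ^ 2 / 4 := by rw [hρ]; ring
      rw [h2] at hs1
      simp only
      rw [ha] at h1
      linarith
    · simp only
      have hxy : dist x y < r₁ / 2 := mem_ball.1 hx
      calc dist w y ≤ dist w x + dist x y := dist_triangle _ _ _
        _ < 2 * ρ + r₁ / 2 := add_lt_add hw hxy
        _ = r₁ := by rw [hρ]; ring
  -- ### higher regularity of the bounded pair `(u, q)`: a representative with `K`-Lipschitz slices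
  have hloc : ∀ z ∈ Ioo a T ×ˢ S,
      IsDistributionalNSSolutionOn
          (parabolicCylinderOpens (2 * ρ) ((min (z.1 + ρ ^ 2) T, z.2) : ℝ × EuclideanSpace ℝ (Fin 3)))
          1 0 u q ∧
        (∀ᵐ w ∂(volume.restrict
            (parabolicCylinder (2 * ρ) ((min (z.1 + ρ ^ 2) T, z.2) : ℝ × EuclideanSpace ℝ (Fin 3)))),
          ‖u w.1 w.2‖ ≤ L) ∧
        ∫⁻ w in parabolicCylinder (2 * ρ) ((min (z.1 + ρ ^ 2) T, z.2) : ℝ × EuclideanSpace ℝ (Fin 3)),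
          ‖q w.1 w.2‖ₑ ^ (3 / 2 : ℝ) ≤ P := by
    intro z hz
    refine ⟨?_, ae_restrict_of_ae_restrict_of_subset (hcyl z hz) hbdQ,
      (lintegral_mono_set (hcyl z hz)).trans hqP⟩
    have hle : parabolicCylinderOpens (2 * ρ) ((min (z.1 + ρ ^ 2) T, z.2) : ℝ × EuclideanSpace ℝ (Fin 3))
        ≤ parabolicCylinderOpens r₁ (((T : ℝ), y) : ℝ × EuclideanSpace ℝ (Fin 3)) := by
      intro w hw
      have hw' : w ∈ parabolicCylinder (2 * ρ) ((min (z.1 + ρ ^ 2) T, z.2) : ℝ × EuclideanSpace ℝ (Fin 3)) :=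
        hw
      exact hcyl z hz hw'
    exact IsDistributionalNSSolutionOn.mono_holds hswq.distributional hle
  obtain ⟨K, V, hVu, hVcont, hCD, -, hbdK⟩ := exists_smooth_representative_of_locally_bounded
    NSBoundedHigherRegularityBounds_holds (w := u) (π := q) isOpen_ball (M := L) (P := P) hρpos hloc 1
  -- the representative is `u` itself on the (open) late region: both are continuous there
  have hsub0 : Ioo a T ×ˢ S ⊆ Ico 0 T ×ˢ (univ : Set (EuclideanSpace ℝ (Fin 3))) :=
    prod_mono (fun t ht => ⟨ha_pos.le.trans ht.1.le, ht.2⟩) (subset_univ _)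
  have hucont : ContinuousOn (uncurry u) (Ioo a T ×ˢ S) := hcl.smooth_velocity.continuousOn.mono hsub0
  have hVeq : EqOn (uncurry V) (uncurry u) (Ioo a T ×ˢ S) :=
    Measure.eqOn_open_of_ae_eq hVu (isOpen_Ioo.prod isOpen_ball) hVcont hucont
  -- Lipschitz slices of `V`, hence of `u`
  have hK₁ : ∀ t ∈ Ioo a T, ∀ z ∈ S, ‖fderiv ℝ (V t) z‖ ≤ K := fun t ht z hz => by
    have h := hbdK 1 le_rfl (t, z) ⟨ht, hz⟩
    rwa [norm_iteratedFDeriv_one] at h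
  have hdiff : ∀ t ∈ Ioo a T, ∀ z ∈ S, DifferentiableAt ℝ (V t) z :=
    fun t ht z hz => (hCD (t, z) ⟨ht, hz⟩).differentiableAt (by simp)
  have hK0 : 0 ≤ K := by
    have h := hK₁ ((a + T) / 2) ⟨by linarith, by linarith⟩ y (mem_ball_self (by positivity))
    exact (norm_nonneg _).trans h
  refine ⟨r₁, a, K, hr₁pos, hr₁r₀, hr₁le1, ha_pos, ha_lt, hK0, fun t ht w hw z hz => ?_⟩
  have hVw : V t w = u t w := hVeq (x := (t, w)) ⟨ht, hw⟩
  have hVz : V t z = u t z := hVeq (x := (t, z)) ⟨ht, hz⟩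
  rw [← hVw, ← hVz]
  exact (convex_ball y (r₁ / 2)).norm_image_sub_le_of_norm_fderiv_le (hdiff t ht) (hK₁ t ht) hz hw

end Summit.NavierStokesRegularity.NavierStokesRegularity.Theorems.TypeITraceScarL3

end
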